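import Summits.BirchSwinnertonDyer.BirchSwinnertonDyer.Theses.LeadingTerm
import Summits.BirchSwinnertonDyer.BirchSwinnertonDyer.Theses.Squeeze
import Summits.BirchSwinnertonDyer.BirchSwinnertonDyer.Theorems.LeadingTermSqueezeUBR2StubTransport
import Summits.BirchSwinnertonDyer.BirchSwinnertonDyer.Theorems.LeadingTermSqueezeUBR2Cells
import Literature.NumberTheory.EllipticCurves.KatoRankBound
import HarnessLib

/-!
# BirchSwinnertonDyer / LeadingTerm — crux `SqueezeUBR2` (stmt-BirchSwinnertonDyer-0145),
# line `Sketch`: inside route LeadingTerm the open cell is `rank ≥ 4` (parity from `PinchPrime`)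

Route LeadingTerm's deciding theorem `closes (hC : Consistency) (hP : PinchPrime) (hUB : SqueezeUBR2)`
already carries the crux `PinchPrime` (stmt-16218: every elliptic `E/ℚ`, globally minimal `W`, has
a good ordinary `p ≥ 5` and a newform `f` with `ord_{T=0} L_p(f, α_p, T) = rank_ℤ E(ℚ)`). This file
records (ideator 2's `parity_of_pinch`, card `Ideas/parity-ratchet-junction.md`, re-proved here):

* `squeezeUB_parity_of_pinchPrime`: `PinchPrime`, the ∀-closure of Kato's corank bound (tree fact
  `kato_selmerCorank_le_order_padicLFunction`: `corank_{ℤ_p} Sel_{p^∞}(E/ℚ) ≤ ord_T L_p` at odd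
  good ordinary `p`; Kato, Astérisque 295 (2004), Thm 18.4) and the `p`-parity theorem (tree fact
  `selmerCorank_mod_two_eq`: `corank Sel_{p^∞} ≡ r_an (mod 2)`; Dokchitser–Dokchitser, Ann. of
  Math. 172 (2010), Thm 1.4 — INLINED as a hypothesis so that `BSDSelmer`/`RootNumber` stay out of
  the import cone) give MORDELL–WEIL parity `Even rank ↔ Even r_an` on globally minimal models: at
  the pinch prime `corank ≤ ord_T L_p = rank ≤ corank` (corank identity,
  `mordellWeilRank_le_selmerCorank`), so `corank = rank`, and `p`-parity transfers.
* `squeezeUBR2_of_pinchPrime_of_ub4`: hence, inside route LeadingTerm, the crux `SqueezeUBR2`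
  follows from the GZK cell (`r_an ≤ 1`, literature debt) and the `rank ≥ 4` cell UB4 alone
  (through the landed `squeezeUB_iff_cells` and the parity ratchet `squeezeUB_ub3_of_parity_of_ub4`):
  the first open cell of the route's UB-hypothesis is `(rank, r_an) = (4, 2)`, "four independent
  points and `w = +1` force `L''(E,1) = 0`".

Both theorems are CONDITIONAL on the two named facts (taken as ∀-closed hypotheses) and on the
route item `PinchPrime`; nothing here closes the crux.
-/

set_option linter.dupNamespace false

namespace Summit.BirchSwinnertonDyer.BirchSwinnertonDyer.Theorems

open scoped MatrixGroups ModularForm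
open CongruenceSubgroup Literature.NumberTheory.EllipticCurves
  Literature.NumberTheory.EllipticCurves.ModularForms WeierstrassCurve
open Summit.BirchSwinnertonDyer.BirchSwinnertonDyer.Theses.LeadingTerm (SqueezeUBR2 PinchPrime)

/-- **Mordell–Weil parity from the pinch prime.** Given Kato's corank bound (∀-closure of the
tree fact `kato_selmerCorank_le_order_padicLFunction`, Kato 2004 Thm 18.4), the `p`-parity
theorem (`corank_{ℤ_p} Sel_{p^∞}(E/ℚ) ≡ ord_{s=1} L(E,s) (mod 2)` at every prime, Dokchitser–
Dokchitser 2010 Thm 1.4, inlined) and route LeadingTerm's crux `PinchPrime` (one good ordinary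
`p ≥ 5` with `ord_{T=0} L_p = rank`), every elliptic `E/ℚ` (globally minimal `W`) satisfies
`rank_ℤ E(ℚ) ≡ ord_{s=1} L(E,s) (mod 2)`: at the pinch prime `corank ≤ ord_T L_p = rank ≤ corank`,
so `corank Sel_{p^∞} = rank`, and `p`-parity transfers the parity to `r_an`. CONDITIONAL on the two
facts. [cite: Kato2004, Thm 18.4] -/
theorem squeezeUB_parity_of_pinchPrime
    (hK : ∀ (W : WeierstrassCurve ℚ) [W.IsElliptic] [W.IsGloballyMinimal] (p : ℕ) [Fact p.Prime]
      {N : ℕ} [NeZero N] {f : CuspForm (Gamma0 N) 2},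
      kato_selmerCorank_le_order_padicLFunction W p (f := f))
    (hpp : ∀ (W : WeierstrassCurve ℚ) [W.IsElliptic] [W.IsGloballyMinimal] (p : ℕ) [Fact p.Prime],
      W.selmerCorank p % 2 = W.analyticRank % 2)
    (hP : PinchPrime) :
    ∀ (W : WeierstrassCurve ℚ) [W.IsElliptic] [W.IsGloballyMinimal],
      Even W.mordellWeilRank ↔ Even W.analyticRank := by
  intro W _ _
  obtain ⟨p, hp, h5, hord, _D, _hD, N, hN, f, hf, horder⟩ := hP W
  -- Kato at the pinch prime: `corank ≤ ord_T L_p = rank`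
  have hle : (W.selmerCorank p : ℕ∞) ≤ (W.mordellWeilRank : ℕ∞) := by
    have h := hK W p (f := f) (by omega) hord hf
    rwa [horder] at h
  have hle' : W.selmerCorank p ≤ W.mordellWeilRank := by exact_mod_cast hle
  -- corank identity: `rank ≤ corank`, hence equality
  have heq : W.selmerCorank p = W.mordellWeilRank :=
    le_antisymm hle' (mordellWeilRank_le_selmerCorank W p)
  -- `p`-parity transfers the parity of `corank = rank` to `r_an`
  have hmod : W.mordellWeilRank % 2 = W.analyticRank % 2 := by rw [← heq]; exact hpp W p
  rw [Nat.even_iff, Nat.even_iff, hmod]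

/-- **Inside route LeadingTerm the crux is its `rank ≥ 4` cell.** Given Kato's corank bound and
`p`-parity (named facts, as hypotheses) and the route's crux `PinchPrime`, `SqueezeUBR2` follows
from the GZK cell (`r_an ≤ 1 → rank ≤ r_an`, Gross–Zagier–Kolyvagin, literature debt) and the cell
UB4 (`4 ≤ rank → 2 ≤ r_an → rank ≤ r_an`) on globally minimal models: Mordell–Weil parity
(`squeezeUB_parity_of_pinchPrime`) empties the cell `rank = 3` (`squeezeUB_ub3_of_parity_of_ub4`),
and `squeezeUB_iff_cells` assembles the crux. CONDITIONAL on the two facts. [cite: Kato2004, Thm 18.4] -/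
theorem squeezeUBR2_of_pinchPrime_of_ub4 :
    (∀ (W : WeierstrassCurve ℚ) [W.IsElliptic] [W.IsGloballyMinimal] (p : ℕ) [Fact p.Prime]
      {N : ℕ} [NeZero N] {f : CuspForm (Gamma0 N) 2},
      kato_selmerCorank_le_order_padicLFunction W p (f := f)) →
    (∀ (W : WeierstrassCurve ℚ) [W.IsElliptic] [W.IsGloballyMinimal] (p : ℕ) [Fact p.Prime],
      W.selmerCorank p % 2 = W.analyticRank % 2) →
    PinchPrime →
    (∀ (W : WeierstrassCurve ℚ) [W.IsElliptic] [W.IsGloballyMinimal],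
      W.analyticRank ≤ 1 → W.mordellWeilRank ≤ W.analyticRank) →
    (∀ (W : WeierstrassCurve ℚ) [W.IsElliptic] [W.IsGloballyMinimal],
      4 ≤ W.mordellWeilRank → 2 ≤ W.analyticRank → W.mordellWeilRank ≤ W.analyticRank) →
    SqueezeUBR2 :=
  fun hK hpp hP hGZK hUB4 =>
    squeezeUB_iff_cells.mpr ⟨hGZK,
      squeezeUB_ub3_of_parity_of_ub4 (squeezeUB_parity_of_pinchPrime hK hpp hP) hUB4⟩

end Summit.BirchSwinnertonDyer.BirchSwinnertonDyer.Theorems
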